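import Summits.ResolutionOfSingularities.ResolutionOfSingularities.Theorems.WildConesCampaignW46Surfaces
import Summits.ResolutionOfSingularities.ResolutionOfSingularities.Theorems.WildConesCampaignW46FormalDictionary
import Literature.AlgebraicGeometry.Resolution.PlaneChartEndomorphism
import HarnessLib

/-!
# [OURS · L1 W4.6, rung (i) SURFACES — brick 29] BRANCHING BOUND of the point-blow-up dynamics of a surface
# `z^p = a(u₁,u₂)`: a forced state has AT MOST THREE forced successors (canonical chart points)

Cell res-hironaka (LADDER-RESOLUTION rung L, D-0089), slot W4.6 «restricted regimes as rungs», seat res-L1-s46-pv-2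
(gen 5: the GEOMETRIC upgrade of the forced-atom rung — finitely many singular points instead of one). Host: route
`WildCones`, crux `ClassicalRegimes` (stmt-ResolutionOfSingularities-16884), `--supports … --as helper`.

HONEST FRAMING. Everything here is OURS: theorems about route `WildCones`' own TYPED point-blow-up dynamics
(`Theorems/WildConesClassicalRegimesDefs.lean`: `step i τ c` = blow up the closed point, chart `u_i`, move to the point
`u_j/u_i = τ_j`, divide by `u_i^p`, delete `p`-th powers; `MultP` = cleaned order `≥ p`, `Isol` = finite Milnor
algebra), via this seat's structure lemma (p469938 `CampaignW46.Surfaces.ord_clean_eq_of_forcedSuccessor`: a surface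
state with a forced successor has cleaned order EXACTLY `p + 1`), the formal dictionary (p471376
`FormalDictionary.subst_chartSubst_ser`: `σ_{i,τ}(a) = u_i^p · T`) and the tree's leading-slice formula
(`PlaneChart.coeff_leading_slice_eq_taylor`, Huneke–Swanson §14.1). NOTHING here is a statement of H. Hironaka's
manuscript [Hironaka2017] and nothing of it is used; no FACT-LIST premise. AI review is weaker than expert review.

## What is proved

* `X_sub_C_pow_dvd_leadingPoly_of_multP_step` — **root condition**: if `a = ser c` has order `≥ p + 1` and the
  successor `step i τ c` has multiplicity `p`, then `τ_j` is a root of multiplicity `≥ p − 1` of the dehomogenised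
  degree-`(p+1)` form `P(X) = Σ_l a_{(p+1−l)eᵢ + l eⱼ} X^l` of `a` in the chart `u_i`: `(X − τ_j)^{p−1} ∣ P`. (The
  coefficient of `u_i u_j^k` in the total transform `T = u_i^{-p} σ_{i,τ}(a)` is the `k`-th Taylor coefficient of `P` at
  `τ_j`; it survives cleaning and has degree `1 + k < p` for `k ≤ p − 2`.)
* `card_le_three_of_forced_successors` — **BRANCHING ≤ 3**: for a surface state `c` of multiplicity `p` and any finite
  set `T` of CANONICAL chart points `(i, τ)` (`τ_l = 0` for `l ≤ i`: the point `u₂/u₁ = τ₂` of the `u₁`-chart, or the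
  origin of the `u₂`-chart) all of whose successors `step i τ c` are FORCED (isolated of multiplicity `p`):
  `#T ≤ 3`. Proof: a forced successor forces `ord a = p + 1` (structure lemma), so `P ≠ 0` has degree `≤ p + 1`;
  distinct `u₁`-chart points give coprime factors `(X − τ)^{p−1}` of `P`, and the `u₂`-origin, if forced, kills the
  coefficients of `P` in degrees `≥ 3`; hence `#T · (p − 1) ≤ p + 1` resp. `(#T − 1)(p − 1) ≤ 2`, i.e. `#T ≤ 3`
  (`= 3` only for `p = 2`; `≤ 2` for `p = 3`; `≤ 1` for `p ≥ 5`).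

ROLE. With the dictionary (bricks 27/28: a singular point of the transform over a forced-atom point IS its canonical
chart datum) this bounds the number of singular points of the transform of an embedded surface `z^p = a(u₁,u₂)` over a
blown-up forced point by `3` — the branching input of the finite-`Sing` forced-atom rung (this seat, gen 5).
References: C. Huneke, I. Swanson, *Integral Closure of Ideals, Rings, and Modules* (2006) §14.1 [HunekeSwanson2006]
(leading slice, through the tree); O. Zariski, P. Samuel, *Commutative Algebra* II (1960) App. 5 [ZariskiSamuel1960];
H. Hironaka, ms. 2017, Th. 16.6 p.84 — ROLE of «the closed points `ξ′ ∈ π⁻¹(ξ)` at which the transform has order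
`≥ b`» only, under adjudication, not cited as fact. [folklore]
-/

noncomputable section

-- single-problem summit: the doubled namespace component `ResolutionOfSingularities` is forced
set_option linter.dupNamespace false

open scoped BigOperators Classical Polynomial
open MvPowerSeries IsLocalRing Finsupp

namespace Summit.ResolutionOfSingularities.ResolutionOfSingularities.Theorems

namespace CampaignW46.SurfaceBranching

open WildCones
open CampaignW46.FormalDictionary
open Summit.ResolutionOfSingularities.ResolutionOfSingularities.Theorems.FrobeniusClosing (chartSubst)
open Summit.ResolutionOfSingularities.ResolutionOfSingularities.Theorems.FrobeniusClosing.FactorizationProof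
open Literature.AlgebraicGeometry.Resolution
open Literature.RingTheory.MvPowerSeries.Jets (le_order_iff_mem_maximalIdeal_pow coeff_eq_zero_of_mem_maximalIdeal_pow)

variable {p : ℕ} {κ : Type} [Field κ]

/-! ## Order `≥ p + 1` read on the series -/

/-- If every cleaned monomial of `c` has degree `≥ N` then `ser c ∈ 𝔪^N`. [folklore] -/
theorem ser_mem_maximalIdeal_pow {n N : ℕ} (c : (Fin n → ℕ) → κ)
    (h : ∀ A : Fin n → ℕ, clean p n κ c A ≠ 0 → N ≤ Finset.sum Finset.univ (fun l => A l)) :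
    ser p n κ c ∈ maximalIdeal (MvPowerSeries (Fin n) κ) ^ N := by
  rw [← le_order_iff_mem_maximalIdeal_pow]
  refine MvPowerSeries.nat_le_order (fun A hA => ?_)
  rw [MuDropCharTwoOrdP.coeff_ser]
  by_contra hne
  have := h (⇑A) hne
  rw [← MuDropCharTwoOrdP.degree_eq_sum_univ] at this
  exact absurd hA (not_lt.mpr (by exact_mod_cast this))

/-- A surface state of multiplicity `p` with a FORCED successor has `ser c ∈ 𝔪^(p+1)` (structure lemma
`ord_clean_eq_of_forcedSuccessor`: cleaned order exactly `p + 1`). [folklore] -/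
theorem ser_mem_maximalIdeal_pow_succ_of_forcedSuccessor (hp : p.Prime) [CharP κ p] [PerfectField κ]
    (c : (Fin 2 → ℕ) → κ) (i : Fin 2) (τ : Fin 2 → κ) (hM : MultP p 2 κ c)
    (hI' : Isol p 2 κ (step p 2 κ i τ c)) (hM' : MultP p 2 κ (step p 2 κ i τ c)) :
    ser p 2 κ c ∈ maximalIdeal (MvPowerSeries (Fin 2) κ) ^ (p + 1) := by
  have hord := Surfaces.ord_clean_eq_of_forcedSuccessor hp c i τ hM hI' hM'
  refine ser_mem_maximalIdeal_pow c fun A hA => ?_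
  rw [← hord]
  unfold ord
  exact Nat.sInf_le ⟨A, hA, rfl⟩

/-! ## The root condition in the chart `u_i` -/

/-- Coefficients of the dehomogenised degree-`d` form `P(X) = Σ_{l ≤ d} a_{(d−l)eᵢ + l eⱼ} X^l`. [folklore] -/
theorem coeff_leadingPoly {d : ℕ} (i j : Fin 2) (a : MvPowerSeries (Fin 2) κ) (m : ℕ) :
    (∑ l ∈ Finset.range (d + 1), Polynomial.C (coeff (single i (d - l) + single j l) a) * Polynomial.X ^ l).coeff m =
      if m ≤ d then coeff (single i (d - m) + single j m) a else 0 := by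
  rw [Polynomial.finsetSum_coeff]
  simp_rw [Polynomial.coeff_C_mul_X_pow]
  rw [Finset.sum_ite_eq (Finset.range (d + 1)) m]
  simp only [Finset.mem_range, Nat.lt_succ_iff]

/-- [OURS · L1 W4.6 rung (i); NOT a statement of the manuscript] **Root condition.** For a surface state `c` of
multiplicity `p` with `ser c ∈ 𝔪^(p+1)` whose successor `step i τ c` in the chart `u_i` at `u_j/u_i = τ_j` has
multiplicity `p`: `(X − τ_j)^{p−1}` divides the dehomogenised degree-`(p+1)` form of `ser c`. [folklore] -/
theorem X_sub_C_pow_dvd_leadingPoly_of_multP_step (hp : p.Prime) (c : (Fin 2 → ℕ) → κ) {i j : Fin 2} (hij : j ≠ i)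
    (τ : Fin 2 → κ) (hM : MultP p 2 κ c) (hord : ser p 2 κ c ∈ maximalIdeal (MvPowerSeries (Fin 2) κ) ^ (p + 1))
    (hM' : MultP p 2 κ (step p 2 κ i τ c)) :
    (Polynomial.X - Polynomial.C (τ j)) ^ (p - 1) ∣
      ∑ l ∈ Finset.range (p + 1 + 1),
        Polynomial.C (coeff (single i (p + 1 - l) + single j l) (ser p 2 κ c)) * Polynomial.X ^ l := by
  set P : κ[X] := ∑ l ∈ Finset.range (p + 1 + 1),
    Polynomial.C (coeff (single i (p + 1 - l) + single j l) (ser p 2 κ c)) * Polynomial.X ^ l with hP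
  -- the chart endomorphism `Θ = σ_{i,τ}` and the dictionary `Θ(a) = u_i^p · T`
  set Θ : MvPowerSeries (Fin 2) κ →ₐ[κ] MvPowerSeries (Fin 2) κ := substAlgHom (hasSubst_chartSubst i τ) with hΘ
  have hΘi : Θ (X i) = X i := by
    rw [hΘ, substAlgHom_apply, subst_X (hasSubst_chartSubst i τ), chartSubst_eq_X_mul, if_pos rfl, mul_one]
  have hΘj : Θ (X j) = X i * (X j + MvPowerSeries.C (τ j)) := by
    rw [hΘ, substAlgHom_apply, subst_X (hasSubst_chartSubst i τ), chartSubst_eq_X_mul, if_neg hij]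
  have hΘa : Θ (ser p 2 κ c) = X i ^ p * moveSer p 2 κ c i τ := by
    rw [hΘ, substAlgHom_apply, subst_chartSubst_ser c i τ hM]
  -- the Taylor coefficients of `P` at `τ_j` below `p − 1` vanish
  have htaylor : ∀ k, k < p - 1 → (Polynomial.taylor (τ j) P).coeff k = 0 := by
    intro k hk
    rw [hP, ← PlaneChart.coeff_leading_slice_eq_taylor hij (τ j) Θ hΘi hΘj hord k, hΘa,
      show single i (p + 1) + single j k = single i p + (single i 1 + single j k) by
        rw [← add_assoc, ← single_add],
      PlaneChart.coeff_single_add_X_pow_mul, coeff_moveSer]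
    -- this coefficient of the total transform survives cleaning and is a coefficient of the successor
    have hstep := MuDropCharTwoOrdP.coeff_ser_step c i τ hM (single i 1 + single j k)
    have hnd : ¬ p ∣ (⇑(single i 1 + single j k : Fin 2 →₀ ℕ)) i := by
      have h1 : (⇑(single i 1 + single j k : Fin 2 →₀ ℕ)) i = 1 := by
        simp [hij]
      rw [h1, Nat.dvd_one]
      exact hp.one_lt.ne'

    rw [OrdPExitSurface.clean_apply_of_not_dvd _ _ i hnd] at hstep
    rw [← hstep]
    -- the successor has multiplicity `p`: its series lies in `𝔪^p`, and `1 + k < p`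
    have hmem : ser p 2 κ (step p 2 κ i τ c) ∈ maximalIdeal (MvPowerSeries (Fin 2) κ) ^ p :=
      le_order_iff_mem_maximalIdeal_pow.mp (MuDropCharTwoOrdP.natCast_le_order_ser hM')
    refine coeff_eq_zero_of_mem_maximalIdeal_pow hmem ?_
    rw [map_add, degree_single, degree_single]
    omega
  -- hence `X^(p-1) ∣ taylor τ_j P`, and translating back `(X − τ_j)^(p−1) ∣ P`
  have hX : (Polynomial.X : κ[X]) ^ (p - 1) ∣ Polynomial.taylor (τ j) P := Polynomial.X_pow_dvd_iff.mpr htaylor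
  obtain ⟨Q, hQ⟩ := hX
  refine ⟨Polynomial.taylor (-τ j) Q, ?_⟩
  calc P = Polynomial.taylor (-τ j) (Polynomial.taylor (τ j) P) := by
        rw [Polynomial.taylor_taylor, neg_add_cancel, Polynomial.taylor_zero]
    _ = (Polynomial.X - Polynomial.C (τ j)) ^ (p - 1) * Polynomial.taylor (-τ j) Q := by
        rw [hQ, Polynomial.taylor_mul, Polynomial.taylor_pow, Polynomial.taylor_X, map_neg, sub_eq_add_neg]

/-! ## Branching ≤ 3 -/

/-- [OURS · L1 W4.6 rung (i) SURFACES — BRANCHING BOUND; replaces the role of a bound on «the closed points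
`ξ′ ∈ π⁻¹(ξ)` at which the transform has order `≥ b`» (H. Hironaka, ms. 2017, Th. 16.6 p.84 l.10) for an embedded
surface `z^p = a(u₁,u₂)` at a forced point; NOT a statement of the manuscript] **A forced surface state has at most
three forced successors.** For `c` of multiplicity `p` over a perfect field of characteristic `p` and a finite set `T`
of canonical chart points `(i, τ)` (`τ_l = 0` for all `l ≤ i`) whose successors `step i τ c` are all isolated of
multiplicity `p`: `#T ≤ 3`. [folklore] -/
theorem card_le_three_of_forced_successors (hp : p.Prime) [CharP κ p] [PerfectField κ]
    (c : (Fin 2 → ℕ) → κ) (hM : MultP p 2 κ c) (T : Finset (Fin 2 × (Fin 2 → κ)))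
    (hT : ∀ d ∈ T, Isol p 2 κ (step p 2 κ d.1 d.2 c) ∧ MultP p 2 κ (step p 2 κ d.1 d.2 c) ∧
      ∀ l : Fin 2, l ≤ d.1 → d.2 l = 0) :
    T.card ≤ 3 := by
  classical
  rcases T.eq_empty_or_nonempty with rfl | ⟨d₀, hd₀⟩
  · simp
  have h10 : (1 : Fin 2) ≠ 0 := by decide
  have h01 : (0 : Fin 2) ≠ 1 := by decide
  -- the order is exactly `p + 1`
  have hord : ser p 2 κ c ∈ maximalIdeal (MvPowerSeries (Fin 2) κ) ^ (p + 1) :=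
    ser_mem_maximalIdeal_pow_succ_of_forcedSuccessor hp c d₀.1 d₀.2 hM (hT d₀ hd₀).1 (hT d₀ hd₀).2.1
  -- the dehomogenised leading form in the chart `u₀`
  set P : κ[X] := ∑ l ∈ Finset.range (p + 1 + 1),
    Polynomial.C (coeff (single (0 : Fin 2) (p + 1 - l) + single 1 l) (ser p 2 κ c)) * Polynomial.X ^ l with hP
  have hPcoeff : ∀ m, P.coeff m =
      if m ≤ p + 1 then coeff (single (0 : Fin 2) (p + 1 - m) + single 1 m) (ser p 2 κ c) else 0 :=
    fun m => coeff_leadingPoly 0 1 _ m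
  -- `P ≠ 0`: a cleaned monomial of degree exactly `p + 1` exists
  have hP0 : P ≠ 0 := by
    obtain ⟨A, hA, hsum⟩ := Surfaces.ordPSucc_of_forcedSuccessor hp c d₀.1 d₀.2 hM (hT d₀ hd₀).1 (hT d₀ hd₀).2.1
    have hsum' : A 0 + A 1 = p + 1 := by rw [← hsum, Fin.sum_univ_two]
    intro h0
    have h := hPcoeff (A 1)
    rw [h0, Polynomial.coeff_zero, if_pos (by omega)] at h
    have hAeq : (single (0 : Fin 2) (p + 1 - A 1) + single 1 (A 1) : Fin 2 →₀ ℕ) = Finsupp.equivFunOnFinite.symm A := by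
      ext l
      fin_cases l
      · simp [single_eq_of_ne h01]; omega
      · simp [single_eq_of_ne h10]
    rw [hAeq, MuDropCharTwoOrdP.coeff_ser, Finsupp.coe_equivFunOnFinite_symm] at h
    exact hA h.symm
  have hPdeg : P.natDegree ≤ p + 1 := by
    rw [Polynomial.natDegree_le_iff_coeff_eq_zero]
    intro m hm
    rw [hPcoeff, if_neg (by exact_mod_cast not_le.mpr hm)]
  -- split `T` by chart index
  set T₀ := T.filter (fun d => d.1 = 0) with hT₀
  set T₁ := T.filter (fun d => ¬ d.1 = 0) with hT₁
  have hcard : T.card = T₀.card + T₁.card := (Finset.card_filter_add_card_filter_not _).symm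
  -- the `u₁`-chart contributes at most the origin
  have hT₁sub : T₁ ⊆ {((1 : Fin 2), (0 : Fin 2 → κ))} := by
    intro d hd
    rw [Finset.mem_filter] at hd
    obtain ⟨hdT, hd1⟩ := hd
    have hd1' : d.1 = 1 := by
      rcases OrdPExitSurface.eq_or_eq 0 1 h10 d.1 with h | h
      · exact absurd h hd1
      · exact h
    rw [Finset.mem_singleton, Prod.ext_iff]
    refine ⟨hd1', funext fun l => (hT d hdT).2.2 l ?_⟩
    rw [hd1']
    exact Fin.le_last l
  have hT₁card : T₁.card ≤ 1 := (Finset.card_le_card hT₁sub).trans (Finset.card_singleton _).le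
  -- the `u₀`-chart points are their residues `τ₁`, each a root of multiplicity `≥ p − 1` of `P`
  set S : Finset κ := T₀.image (fun d => d.2 1) with hS
  have hSinj : Set.InjOn (fun d : Fin 2 × (Fin 2 → κ) => d.2 1) T₀ := by
    intro d hd d' hd' h
    rw [Finset.mem_coe, Finset.mem_filter] at hd hd'
    refine Prod.ext (hd.2.trans hd'.2.symm) (funext fun l => ?_)
    rcases OrdPExitSurface.eq_or_eq 0 1 h10 l with rfl | rfl
    · rw [(hT d hd.1).2.2 0 (by rw [hd.2]), (hT d' hd'.1).2.2 0 (by rw [hd'.2])]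
    · exact h
  have hScard : S.card = T₀.card := Finset.card_image_of_injOn hSinj
  have hSdvd : ∀ t ∈ S, (Polynomial.X - Polynomial.C t) ^ (p - 1) ∣ P := by
    intro t ht
    obtain ⟨d, hd, rfl⟩ := Finset.mem_image.mp ht
    rw [Finset.mem_filter] at hd
    have h := X_sub_C_pow_dvd_leadingPoly_of_multP_step hp c (i := 0) (j := 1) h10 d.2 hM hord
      (by rw [← hd.2]; exact (hT d hd.1).2.1)
    exact h
  have hprod : (∏ t ∈ S, (Polynomial.X - Polynomial.C t) ^ (p - 1)) ∣ P := by
    refine Finset.prod_dvd_of_coprime (fun t _ t' _ htt' => ?_) hSdvd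
    exact (Polynomial.isCoprime_X_sub_C_of_isUnit_sub (sub_ne_zero_of_ne htt').isUnit).pow
  have hdegprod : (∏ t ∈ S, (Polynomial.X - Polynomial.C t) ^ (p - 1)).natDegree = S.card * (p - 1) := by
    rw [Polynomial.natDegree_prod_of_monic _ _ (fun t _ => (Polynomial.monic_X_sub_C t).pow _)]
    simp_rw [(Polynomial.monic_X_sub_C _).natDegree_pow, Polynomial.natDegree_X_sub_C, mul_one]
    rw [Finset.sum_const, smul_eq_mul]
  have hSle : S.card * (p - 1) ≤ P.natDegree := hdegprod ▸ Polynomial.natDegree_le_of_dvd hprod hP0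
  have hp2 := hp.two_le
  -- case: is the `u₁`-origin forced?
  by_cases hT₁e : T₁ = ∅
  · -- no: `#T = #S` and `#S (p−1) ≤ p + 1`
    rw [hcard, hT₁e, Finset.card_empty, add_zero, ← hScard]
    by_contra hlt
    have h4 : 4 * (p - 1) ≤ S.card * (p - 1) := Nat.mul_le_mul_right _ (by omega)
    have := (h4.trans hSle).trans hPdeg
    omega
  · -- yes: the origin of the `u₁`-chart kills the coefficients of `P` in degrees `≥ 3`
    obtain ⟨d₁, hd₁⟩ := Finset.nonempty_iff_ne_empty.mpr hT₁e
    have hd₁eq : d₁ = ((1 : Fin 2), (0 : Fin 2 → κ)) := Finset.mem_singleton.mp (hT₁sub hd₁)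
    have hd₁T : ((1 : Fin 2), (0 : Fin 2 → κ)) ∈ T := by
      rw [← hd₁eq]; exact (Finset.mem_filter.mp hd₁).1
    have hroot := X_sub_C_pow_dvd_leadingPoly_of_multP_step hp c (i := 1) (j := 0) h01 0 hM hord (hT _ hd₁T).2.1
    rw [Pi.zero_apply, map_zero, sub_zero, Polynomial.X_pow_dvd_iff] at hroot
    have hPdeg2 : P.natDegree ≤ 2 := by
      rw [Polynomial.natDegree_le_iff_coeff_eq_zero]
      intro m hm
      have hm3 : 3 ≤ m := by exact_mod_cast hm
      rw [hPcoeff]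
      split_ifs with hmle
      · have h := hroot (p + 1 - m) (by omega)
        rw [coeff_leadingPoly, if_pos (by omega), show p + 1 - (p + 1 - m) = m by omega, add_comm] at h
        exact h
      · rfl
    rw [hcard, ← hScard]
    have hS2 : S.card * (p - 1) ≤ 2 := hSle.trans hPdeg2
    by_contra hlt
    have h3 : 3 ≤ S.card := by omega
    have h4 : 3 * (p - 1) ≤ S.card * (p - 1) := Nat.mul_le_mul_right _ h3
    omega

end CampaignW46.SurfaceBranching

end Summit.ResolutionOfSingularities.ResolutionOfSingularities.Theorems

end
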